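import Summits.QuantumFields.YangMills.Theorems.DressedRitz.Negative.BlockRotationEngine
import Summits.QuantumFields.YangMills.Theorems.DressedRitz.Negative.BlockToFineLoadBearing
import Summits.QuantumFields.YangMills.Theorems.LuscherReductionDressedRitzPolyakovLiftBlockLeakage
import HarnessLib

/-!
# Crux `DressedRitz` (stmt-QuantumFields-20205), line «polyakovlift» r8 → r9 — the `∀`-basis BLOCK-LEAKAGE text `BlockLeakageForL (TransplantBasisLR k)`
# read through the level-rotation closure: ★★ BLOCK-RITZ-VALUE AGREEMENT (dressed AND raw) across every degenerate excited level of `𝔥`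

Standing crux disprover `ym-cdisprove-20205-1` g14 (refuter), supporting item stmt-QuantumFields-20205 (no verdict change; negative-side bookkeeping for
the provers of the r9 stub `stub_blockLeakage : ∀ k, BlockLeakageForL (TransplantBasisLR k)` — LEAD g4's block-currency re-cut, pen `Lines-polyakovlift-r9.lean`;
the text itself is tree p586831).  Work file `Cruxes/DressedRitz/Disproof.lean` §18.  This is the r9 twin of g11's `LevelRotationLeakage` (fine (o4)): the block
clauses are no more rotation-covariant than (o4), and the registered basis class is closed under rotations inside a degenerate level
(`Negative.transplantBasisLR_levelRotation`, g10); the engine (abstract symmetric `T`, block `P = K_β^[m]`, block clause ⟹ defect bound) is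
`Negative/BlockRotationEngine.lean`.

* §3 ★★ THE NECESSARY CONDITIONS of `BlockLeakageForL (TransplantBasisLR k)` with the SAME `C, lam0, L0(lam)`: for `β` in the femto window, raw vacuum `φ`,
  admissible `(f, R)`, excited indices `a ≠ b` with `physLevel (a+2) = physLevel (b+2)`, block `P = K_β^[L]` (`dressSteps L = L`):
  DRESSED lifts `u_i = dressedLiftVec β φ (transplantObsL L λ R f i)`: `(⟨u_a,Pu_a⟩/‖u_a‖² − ⟨u_b,Pu_b⟩/‖u_b‖²)² ≤ 32·C·λ³·λ₀^{2L}`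
  (`blockLeakageForL_transplantLR_levelBlockRitzAgreement`, primed version with non-nullity discharged by `o0_level_transplantLR`);
  RAW lifts `v_i = liftVec β φ (…)` — i.e. the normalised diagonal BLOCK CORRELATORS `C_aa(L)/C_aa(0)` of the flowed, vacuum-subtracted Polyakov insertions:
  the same bound (`blockLeakageForL_transplantLR_levelRawBlockRitzAgreement`).
* §4 SHARP ORDER: the equal mixture of two orthonormal exact eigenvectors passes the block clause iff `(κ₁^m − κ₂^m)² ≤ δ(κ₁^m + κ₂^m)²`
  (`blockClause_mixture_iff`) — so `√δ = √C·λ^{3/2}` IS the relative block-Ritz splitting the `∀`-basis text tolerates across a degenerate level, i.e.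
  `L·|E_a − E_b| ≲ √C·λ^{3/2}` for the effective energies of the two dressed lifts.

WHERE IT BITES ∕ PHYSICS: from `k = 2` (the `E⁺ ⊕ T₂⁺` quintet of the spatially `O(3)`-symmetric `𝔥`, g10 `LevelRotationBalance`); the lattice splits the quintet
only at relative `O(λ³)` (`L·ΔE = O(λ⁴)`), and the raw correlator ratios of the `E`/`T₂` members differ by `O(λ²)·O(λ)` — both inside `√C·λ^{3/2}`: a LOCATED-GAP
test (a supplier whose block-defect constant is certified only on cubic-isotype-ALIGNED bases does not cover the registered `∀`-basis text), never a kill.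
HONEST FRAMING: negative-side bookkeeping on the CONDITIONAL femto rung R2b1; nothing here asserts or refutes a route item, and nothing bears on infinite volume,
the continuum limit or the Clay gap.  References: M. Lüscher, NPB 219 (1983) 233 [cite: Luscher1983, §2–§3]; M. Lüscher, G. Münster, NPB 232 (1984) 445
[cite: LuscherMunster1984, §4]; P. van Baal, hep-ph/0008206 [cite: Vanbaal2001, §4]; M. Lüscher, U. Wolff, NPB 339 (1990) 222 [cite: LuscherWolff1990];
C. Davis, W. M. Kahan, SIAM J. Numer. Anal. 7 (1970) 1 [cite: DavisKahan1970, §2].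
-/

set_option autoImplicit false

noncomputable section

open MeasureTheory Filter Topology Real
open Literature.MathematicalPhysics.QuantumFieldTheory Literature.MathematicalPhysics.QuantumLattice Literature.Analysis.OperatorTheory.YMMatrixModel
open scoped BigOperators

namespace Summit.QuantumFields.YangMills.Theorems.FemtoTransferGap.PolyakovLift.Negative

open Summit.QuantumFields.YangMills.Theorems.FemtoTransferGap Summit.QuantumFields.YangMills.Theorems.FemtoTransferGap.PolyakovLift

/-! ## §3 ★★ The necessary conditions of the registered block-leakage text across a degenerate level -/

/-- ★★ **DRESSED BLOCK-RITZ-VALUE AGREEMENT across a degenerate level — a necessary condition of `BlockLeakageForL (TransplantBasisLR k)` (r9 `stub_blockLeakage`)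
with the SAME `C, lam0, L0(lam)`**: for `β` in the femto window, raw vacuum `φ`, AL1 family `f` (`f_0 > 0`), admissible `R`, excited indices `a ≠ b` with
`physLevel (a+2) = physLevel (b+2)`, and `P = K_β^[dressSteps L]`, if the dressed lifts `u_i = dressedLiftVec β φ (transplantObsL L λ R f i)` are non-null then
`(⟨u_a,Pu_a⟩/‖u_a‖² − ⟨u_b,Pu_b⟩/‖u_b‖²)² ≤ 32·C·λ³·λ₀^{2·dressSteps L}`.  Proof: the basis rotated inside the level is admissible (`transplantBasisLR_levelRotation`),
its dressed lifts are the rotated dressed lifts, so the DRESSED block clause holds for every rotation of the pair; §2 turns each clause into a defect bound for `P`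
with `E = Cλ³·λ₀^{2L}`; then §1.  Bites on the `E⁺ ⊕ T₂⁺` quintet (from `k = 2`); physically met (`L·ΔE = O(λ⁴) ≪ √C·λ^{3/2}`).
[cite: Luscher1983, §2–§3] [cite: LuscherMunster1984, §4] [cite: Vanbaal2001, §4] [cite: LuscherWolff1990] -/
theorem blockLeakageForL_transplantLR_levelBlockRitzAgreement (k : ℕ) (hK : BlockLeakageForL (TransplantBasisLR k)) :
    ∃ C lam0 : ℝ, 0 ≤ C ∧ 0 < lam0 ∧ ∀ lam : ℝ, 0 < lam → lam ≤ lam0 → ∃ L0 : ℕ,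
      ∀ (L : ℕ) [NeZero L], L0 ≤ L → ∀ β : ℝ, InFemtoWindow lam β L →
        ∀ φ : GaugeConfig 3 L SU2 → ℝ, IsRawVacuum β φ →
          ∀ (f : Fin (k + 1) → ZM → ℝ) (R : ℝ), IsEigenFamily k f → (∀ x, 0 < f 0 x) → 1 ≤ R →
            1 ≤ R ^ 4 * luscherLambda β L → R * luscherLambda β L ≤ 1 / 4 →
              ∀ a b : Fin k, a ≠ b → physLevel ((a : ℕ) + 2) = physLevel ((b : ℕ) + 2) →
                let ua := dressedLiftVec β φ (transplantObsL L (luscherLambda β L) R f a)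
                let ub := dressedLiftVec β φ (transplantObsL L (luscherLambda β L) R f b)
                0 < l2 ua ua → 0 < l2 ub ub →
                  (l2 ua ((transferApply β)^[dressSteps L] ua) / l2 ua ua - l2 ub ((transferApply β)^[dressSteps L] ub) / l2 ub ub) ^ 2 ≤
                    32 * C * luscherLambda β L ^ 3 * levelValue su2Rep L β 0 ^ (2 * dressSteps L) := by
  obtain ⟨C, lam0, hC, hlam0, hmain⟩ := hK
  refine ⟨C, lam0, hC, hlam0, fun lam hlam hle => ?_⟩
  obtain ⟨L0, hL⟩ := hmain lam hlam hle
  refine ⟨L0, fun L _ hL0 β hW φ hφ f R hf hpos hR1 hR4 hRΛ a b hab hdeg => ?_⟩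
  intro ua ub hna hnb
  have hβ : 0 ≤ β := zero_le_one.trans hW.1
  have hgB : TransplantBasisLR k L (luscherLambda β L) (fun i => transplantObsL L (luscherLambda β L) R f i) :=
    ⟨f, R, hf, hpos, hR1, hR4, hRΛ, fun _ => rfl⟩
  set m := dressSteps L with hm
  set Ta := transplantObsL L (luscherLambda β L) R f a with hTa
  set Tb := transplantObsL L (luscherLambda β L) R f b with hTb
  have hTa_phys : IsPhys Ta := basisPhysL_transplantBasisLR k L _ _ hgB a
  have hTb_phys : IsPhys Tb := basisPhysL_transplantBasisLR k L _ _ hgB b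
  have hua_phys : IsPhys ua := isPhys_dressedLiftVec β hφ.1 hTa_phys
  have hub_phys : IsPhys ub := isPhys_dressedLiftVec β hφ.1 hTb_phys
  set E : ℝ := C * luscherLambda β L ^ 3 * levelValue su2Rep L β 0 ^ (2 * m) with hE
  have hδ : 0 ≤ C * luscherLambda β L ^ 3 := mul_nonneg hC (pow_nonneg (luscherLambda_pos_of_window hlam hW).le 3)
  -- the dressed block clause of a member of an admissible basis, as a defect bound for `P = K^[m]`
  have hclause : ∀ (g : Fin k → (Cfg → ℝ)), TransplantBasisLR k L (luscherLambda β L) g → ∀ i : Fin k,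
      l2 ((transferApply β)^[m] (dressedLiftVec β φ (g i))) ((transferApply β)^[m] (dressedLiftVec β φ (g i))) *
            l2 (dressedLiftVec β φ (g i)) (dressedLiftVec β φ (g i)) -
          l2 (dressedLiftVec β φ (g i)) ((transferApply β)^[m] (dressedLiftVec β φ (g i))) ^ 2 ≤
        E * l2 (dressedLiftVec β φ (g i)) (dressedLiftVec β φ (g i)) ^ 2 := by
    intro g hg i
    have hgi : IsPhys (g i) := basisPhysL_transplantBasisLR k L _ _ hg i
    obtain ⟨-, hdress⟩ := hL L hL0 β hW φ hφ g hg i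
    rw [hE, hm]
    exact blockDefect_le_of_blockClause (L := L) hβ (isPhys_dressedLiftVec β hφ.1 hgi) (dressSteps L) hδ hdress
  have hleak_u := hclause _ hgB a
  have hleak_v := hclause _ hgB b
  -- the clause for every rotation of the pair inside the degenerate level
  have hleak_rot : ∀ c s : ℝ, c ^ 2 + s ^ 2 = 1 →
      l2 ((transferApply β)^[m] (c • ua + s • ub)) ((transferApply β)^[m] (c • ua + s • ub)) * l2 (c • ua + s • ub) (c • ua + s • ub) -
          l2 (c • ua + s • ub) ((transferApply β)^[m] (c • ua + s • ub)) ^ 2 ≤ E * l2 (c • ua + s • ub) (c • ua + s • ub) ^ 2 := by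
    intro c s hcs
    obtain ⟨g', hga, hgb, hgj⟩ : ∃ g' : Fin k → (Cfg → ℝ),
        g' a = c • Ta + s • Tb ∧ g' b = (-s) • Ta + c • Tb ∧
          ∀ i, i ≠ a → i ≠ b → g' i = transplantObsL L (luscherLambda β L) R f i :=
      ⟨fun i => if i = a then c • Ta + s • Tb else if i = b then (-s) • Ta + c • Tb else transplantObsL L (luscherLambda β L) R f i,
        by simp, by simp [hab.symm], fun i h1 h2 => by simp [h1, h2]⟩
    have hg'B : TransplantBasisLR k L (luscherLambda β L) g' :=
      transplantBasisLR_levelRotation hgB hab hdeg.symm hcs hga hgb hgj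
    have e_a : dressedLiftVec β φ (g' a) = c • ua + s • ub := by
      rw [hga, dressedLiftVec_add β hφ.1 (hTa_phys.smul c) (hTb_phys.smul s), dressedLiftVec_smul, dressedLiftVec_smul]
    have h := hclause g' hg'B a
    rw [e_a] at h
    exact h
  have hres := symmOp_ritz_sub_sq_le_of_rotationDefect (iterate_phys β m) (iterate_smul' β m) (iterate_add' β m) (iterate_symm β m)
    hua_phys hub_phys hna hnb hleak_u hleak_v hleak_rot
  calc _ ≤ 32 * E := hres
    _ = 32 * C * luscherLambda β L ^ 3 * levelValue su2Rep L β 0 ^ (2 * m) := by rw [hE]; ring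

/-- ★★ **The same necessary condition with non-nullity discharged** (`o0_level_transplantLR`), at the price of a possibly smaller `lam0`.
[cite: Luscher1983, §2–§3] [cite: Vanbaal2001, §4] [cite: LuscherWolff1990] -/
theorem blockLeakageForL_transplantLR_levelBlockRitzAgreement' (k : ℕ) (hK : BlockLeakageForL (TransplantBasisLR k)) :
    ∃ C lam0 : ℝ, 0 ≤ C ∧ 0 < lam0 ∧ ∀ lam : ℝ, 0 < lam → lam ≤ lam0 → ∃ L0 : ℕ,
      ∀ (L : ℕ) [NeZero L], L0 ≤ L → ∀ β : ℝ, InFemtoWindow lam β L →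
        ∀ φ : GaugeConfig 3 L SU2 → ℝ, IsRawVacuum β φ →
          ∀ (f : Fin (k + 1) → ZM → ℝ) (R : ℝ), IsEigenFamily k f → (∀ x, 0 < f 0 x) → 1 ≤ R →
            1 ≤ R ^ 4 * luscherLambda β L → R * luscherLambda β L ≤ 1 / 4 →
              ∀ a b : Fin k, a ≠ b → physLevel ((a : ℕ) + 2) = physLevel ((b : ℕ) + 2) →
                let ua := dressedLiftVec β φ (transplantObsL L (luscherLambda β L) R f a)
                let ub := dressedLiftVec β φ (transplantObsL L (luscherLambda β L) R f b)
                (l2 ua ((transferApply β)^[dressSteps L] ua) / l2 ua ua - l2 ub ((transferApply β)^[dressSteps L] ub) / l2 ub ub) ^ 2 ≤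
                  32 * C * luscherLambda β L ^ 3 * levelValue su2Rep L β 0 ^ (2 * dressSteps L) := by
  obtain ⟨C, lam0, hC, hlam0, hmain⟩ := blockLeakageForL_transplantLR_levelBlockRitzAgreement k hK
  obtain ⟨lam1, hlam1, h0⟩ := o0_level_transplantLR k
  refine ⟨C, min lam0 lam1, hC, lt_min hlam0 hlam1, fun lam hlam hle => ?_⟩
  obtain ⟨L0, hL⟩ := hmain lam hlam (hle.trans (min_le_left _ _))
  refine ⟨L0, fun L _ hL0 β hW φ hφ f R hf hpos hR1 hR4 hRΛ a b hab hdeg => ?_⟩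
  intro ua ub
  have hgB : TransplantBasisLR k L (luscherLambda β L) (fun i => transplantObsL L (luscherLambda β L) R f i) :=
    ⟨f, R, hf, hpos, hR1, hR4, hRΛ, fun _ => rfl⟩
  have ho0 := h0 lam hlam (hle.trans (min_le_right _ _)) L β hW φ hφ _ hgB
  exact hL L hL0 β hW φ hφ f R hf hpos hR1 hR4 hRΛ a b hab hdeg (ho0 a) (ho0 b)

/-- ★★ **RAW BLOCK-RITZ-VALUE AGREEMENT across a degenerate level — the RAW clause of `BlockLeakageForL (TransplantBasisLR k)` read through the rotation
closure**, SAME `C, lam0, L0(lam)`: with `v_i = liftVec β φ (transplantObsL L λ R f i)` (the time-0 lifts; `⟨v,K^{L}v⟩/‖v‖²` is the normalised diagonal block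
correlator `C_ii(L)/C_ii(0)` of the flowed, vacuum-subtracted insertion), if `v_a, v_b` are non-null then
`(⟨v_a,Pv_a⟩/‖v_a‖² − ⟨v_b,Pv_b⟩/‖v_b‖²)² ≤ 32·C·λ³·λ₀^{2·dressSteps L}` for every degenerate excited pair `a ≠ b`. [cite: Luscher1983, §2–§3] [cite: LuscherWolff1990] -/
theorem blockLeakageForL_transplantLR_levelRawBlockRitzAgreement (k : ℕ) (hK : BlockLeakageForL (TransplantBasisLR k)) :
    ∃ C lam0 : ℝ, 0 ≤ C ∧ 0 < lam0 ∧ ∀ lam : ℝ, 0 < lam → lam ≤ lam0 → ∃ L0 : ℕ,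
      ∀ (L : ℕ) [NeZero L], L0 ≤ L → ∀ β : ℝ, InFemtoWindow lam β L →
        ∀ φ : GaugeConfig 3 L SU2 → ℝ, IsRawVacuum β φ →
          ∀ (f : Fin (k + 1) → ZM → ℝ) (R : ℝ), IsEigenFamily k f → (∀ x, 0 < f 0 x) → 1 ≤ R →
            1 ≤ R ^ 4 * luscherLambda β L → R * luscherLambda β L ≤ 1 / 4 →
              ∀ a b : Fin k, a ≠ b → physLevel ((a : ℕ) + 2) = physLevel ((b : ℕ) + 2) →
                let va := liftVec β φ (transplantObsL L (luscherLambda β L) R f a)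
                let vb := liftVec β φ (transplantObsL L (luscherLambda β L) R f b)
                0 < l2 va va → 0 < l2 vb vb →
                  (l2 va ((transferApply β)^[dressSteps L] va) / l2 va va - l2 vb ((transferApply β)^[dressSteps L] vb) / l2 vb vb) ^ 2 ≤
                    32 * C * luscherLambda β L ^ 3 * levelValue su2Rep L β 0 ^ (2 * dressSteps L) := by
  obtain ⟨C, lam0, hC, hlam0, hmain⟩ := hK
  refine ⟨C, lam0, hC, hlam0, fun lam hlam hle => ?_⟩
  obtain ⟨L0, hL⟩ := hmain lam hlam hle
  refine ⟨L0, fun L _ hL0 β hW φ hφ f R hf hpos hR1 hR4 hRΛ a b hab hdeg => ?_⟩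
  intro va vb hna hnb
  have hβ : 0 ≤ β := zero_le_one.trans hW.1
  have hgB : TransplantBasisLR k L (luscherLambda β L) (fun i => transplantObsL L (luscherLambda β L) R f i) :=
    ⟨f, R, hf, hpos, hR1, hR4, hRΛ, fun _ => rfl⟩
  set m := dressSteps L with hm
  set Ta := transplantObsL L (luscherLambda β L) R f a with hTa
  set Tb := transplantObsL L (luscherLambda β L) R f b with hTb
  have hTa_phys : IsPhys Ta := basisPhysL_transplantBasisLR k L _ _ hgB a
  have hTb_phys : IsPhys Tb := basisPhysL_transplantBasisLR k L _ _ hgB b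
  have hva_phys : IsPhys va := isPhys_liftVec β hφ.1 hTa_phys
  have hvb_phys : IsPhys vb := isPhys_liftVec β hφ.1 hTb_phys
  set E : ℝ := C * luscherLambda β L ^ 3 * levelValue su2Rep L β 0 ^ (2 * m) with hE
  have hδ : 0 ≤ C * luscherLambda β L ^ 3 := mul_nonneg hC (pow_nonneg (luscherLambda_pos_of_window hlam hW).le 3)
  have hclause : ∀ (g : Fin k → (Cfg → ℝ)), TransplantBasisLR k L (luscherLambda β L) g → ∀ i : Fin k,
      l2 ((transferApply β)^[m] (liftVec β φ (g i))) ((transferApply β)^[m] (liftVec β φ (g i))) * l2 (liftVec β φ (g i)) (liftVec β φ (g i)) -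
          l2 (liftVec β φ (g i)) ((transferApply β)^[m] (liftVec β φ (g i))) ^ 2 ≤
        E * l2 (liftVec β φ (g i)) (liftVec β φ (g i)) ^ 2 := by
    intro g hg i
    have hgi : IsPhys (g i) := basisPhysL_transplantBasisLR k L _ _ hg i
    obtain ⟨hraw, -⟩ := hL L hL0 β hW φ hφ g hg i
    rw [hE, hm]
    exact blockDefect_le_of_blockClause (L := L) hβ (isPhys_liftVec β hφ.1 hgi) (dressSteps L) hδ hraw
  have hleak_u := hclause _ hgB a
  have hleak_v := hclause _ hgB b
  have hleak_rot : ∀ c s : ℝ, c ^ 2 + s ^ 2 = 1 →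
      l2 ((transferApply β)^[m] (c • va + s • vb)) ((transferApply β)^[m] (c • va + s • vb)) * l2 (c • va + s • vb) (c • va + s • vb) -
          l2 (c • va + s • vb) ((transferApply β)^[m] (c • va + s • vb)) ^ 2 ≤ E * l2 (c • va + s • vb) (c • va + s • vb) ^ 2 := by
    intro c s hcs
    obtain ⟨g', hga, hgb, hgj⟩ : ∃ g' : Fin k → (Cfg → ℝ),
        g' a = c • Ta + s • Tb ∧ g' b = (-s) • Ta + c • Tb ∧
          ∀ i, i ≠ a → i ≠ b → g' i = transplantObsL L (luscherLambda β L) R f i :=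
      ⟨fun i => if i = a then c • Ta + s • Tb else if i = b then (-s) • Ta + c • Tb else transplantObsL L (luscherLambda β L) R f i,
        by simp, by simp [hab.symm], fun i h1 h2 => by simp [h1, h2]⟩
    have hg'B : TransplantBasisLR k L (luscherLambda β L) g' :=
      transplantBasisLR_levelRotation hgB hab hdeg.symm hcs hga hgb hgj
    have e_a : liftVec β φ (g' a) = c • va + s • vb := by
      rw [hga, liftVec_add β hφ.1 (hTa_phys.smul c) (hTb_phys.smul s), liftVec_smul, liftVec_smul]
    have h := hclause g' hg'B a
    rw [e_a] at h
    exact h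
  have hres := symmOp_ritz_sub_sq_le_of_rotationDefect (iterate_phys β m) (iterate_smul' β m) (iterate_add' β m) (iterate_symm β m)
    hva_phys hvb_phys hna hnb hleak_u hleak_v hleak_rot
  calc _ ≤ 32 * E := hres
    _ = 32 * C * luscherLambda β L ^ 3 * levelValue su2Rep L β 0 ^ (2 * m) := by rw [hE]; ring

/-! ## §4 Sharpness of the order: the block clause of an equal mixture of two orthonormal exact eigenvectors -/

/-- **The equal mixture passes the block clause iff the block-Ritz splitting is at most `√δ` of the block-Ritz sum**: for orthonormal physical exact
eigenvectors `K_βψ_i = κ_iψ_i`, `w = ψ₁ + ψ₂` satisfies `⟨w,K^{2m}w⟩⟨w,w⟩ ≤ (1+δ)⟨w,K^{m}w⟩²` iff `(κ₁^m − κ₂^m)² ≤ δ(κ₁^m + κ₂^m)²`. [folklore] -/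
theorem blockClause_mixture_iff {L : ℕ} [NeZero L] (β δ : ℝ) {ψ₁ ψ₂ : GaugeConfig 3 L SU2 → ℝ} {κ₁ κ₂ : ℝ} (h₁ : IsPhys ψ₁) (h₂ : IsPhys ψ₂)
    (he₁ : transferApply β ψ₁ = κ₁ • ψ₁) (he₂ : transferApply β ψ₂ = κ₂ • ψ₂)
    (hn₁ : l2 ψ₁ ψ₁ = 1) (hn₂ : l2 ψ₂ ψ₂ = 1) (h₁₂ : l2 ψ₁ ψ₂ = 0) (m : ℕ) :
    l2 (ψ₁ + (1 : ℝ) • ψ₂) ((transferApply β)^[2 * m] (ψ₁ + (1 : ℝ) • ψ₂)) * l2 (ψ₁ + (1 : ℝ) • ψ₂) (ψ₁ + (1 : ℝ) • ψ₂) ≤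
        (1 + δ) * l2 (ψ₁ + (1 : ℝ) • ψ₂) ((transferApply β)^[m] (ψ₁ + (1 : ℝ) • ψ₂)) ^ 2 ↔
      (κ₁ ^ m - κ₂ ^ m) ^ 2 ≤ δ * (κ₁ ^ m + κ₂ ^ m) ^ 2 := by
  have h0 := l2_mixture_self_iterate β h₁ h₂ he₁ he₂ hn₁ hn₂ h₁₂ 1 0
  have hm1 := l2_mixture_self_iterate β h₁ h₂ he₁ he₂ hn₁ hn₂ h₁₂ 1 m
  have hm2 := l2_mixture_self_iterate β h₁ h₂ he₁ he₂ hn₁ hn₂ h₁₂ 1 (2 * m)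
  simp only [Function.iterate_zero, id_eq, pow_zero, one_pow, one_mul, mul_one] at h0 hm1 hm2
  rw [h0, hm1, hm2, pow_mul', pow_mul']
  constructor
  · intro h; nlinarith [h]
  · intro h; nlinarith [h]

end Summit.QuantumFields.YangMills.Theorems.FemtoTransferGap.PolyakovLift.Negative

end
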